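import Literature.AlgebraicGeometry.HodgeTheory.CyclicReflectionEigenprojectors
import HarnessLib

/-!
# `V ⊗ ℂ = ⊕_{a<p} H(ζ^a)` as an internal direct sum (Carlson–Toledo 1999 §2: "the eigenspace decomposition
# of `σ`") — lane D, hole S6 (the collected basis adapted to the eigenspaces)

Family `hodge`, layer `Literature/AlgebraicGeometry/HodgeTheory`. THEOREMS only, for crux K1 of
`Summits/HodgeConjecture/HodgeConjecture/Theses/CyclicUnitaryPowers.lean` (lane D glue, hole S6: the block section
is written in a basis of `V ⊗ ℂ` collected from bases of the eigenspaces, `DirectSum.IsInternal.collectedBasis`).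
The eigenspaces of `τ ⊗ ℂ` at the distinct eigenvalues `ζ^a`, `a < p`, are independent (Mathlib) and span (the
eigenprojectors sum to the identity), hence form an internal direct sum. (The companion dimension statements
are in `CyclicEigenspaceDimensions`.)
Written by the prover seat `hodge-nonav-prover-Ax`.

## References
* [CarlsonToledo1999] J. A. Carlson, D. Toledo, Duke Math. J. 97 (1999), §2 (p. 5).
-/

noncomputable section

open Module Literature.AlgebraicGeometry.Motives
open scoped TensorProduct

namespace Literature.AlgebraicGeometry.HodgeTheory

universe v

variable {V : Type v} [AddCommGroup V] [Module ℚ V]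

/-- The eigenspaces `H(ζ^a)`, `a < p`, span `V ⊗ ℂ` (`Σ_a π_a = id`). [cite: CarlsonToledo1999, §2 (p. 5)] -/
theorem iSup_eigenspace_pow_eq_top {τ : V →ₗ[ℚ] V} {p : ℕ} (hτ : τ ^ p = 1) {ζ : ℂ} (hζ : IsPrimitiveRoot ζ p)
    (hp : 0 < p) : (⨆ a : Fin p, Module.End.eigenspace (τ.baseChange ℂ) (ζ ^ (a : ℕ))) = ⊤ := by
  have hζ0 : ζ ≠ 0 := hζ.ne_zero hp.ne'
  rw [eq_top_iff]
  intro x _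
  rw [← sum_cyclicEigenProjector (τ := τ) hζ hp x, Finset.sum_range]
  exact Submodule.sum_mem _ fun a _ =>
    Submodule.mem_iSup_of_mem a (cyclicEigenProjector_mem_eigenspace hτ hζ.pow_eq_one hζ0 a x)

/-- The eigenspaces `H(ζ^a)`, `a < p`, are independent (distinct eigenvalues). [cite: CarlsonToledo1999, §2 (p. 5)] -/
theorem iSupIndep_eigenspace_pow {τ : V →ₗ[ℚ] V} {p : ℕ} {ζ : ℂ} (hζ : IsPrimitiveRoot ζ p) :
    iSupIndep fun a : Fin p => Module.End.eigenspace (τ.baseChange ℂ) (ζ ^ (a : ℕ)) := by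
  have hinj : Function.Injective fun a : Fin p => ζ ^ (a : ℕ) := fun a b h => Fin.ext (hζ.pow_inj a.2 b.2 h)
  exact (Module.End.eigenspaces_iSupIndep (τ.baseChange ℂ)).comp hinj

/-- **`V ⊗ ℂ = ⊕_{a<p} H(ζ^a)` (internal direct sum)** for a rational `τ` with `τ^p = 1` and `ζ` a primitive `p`-th
root of unity. [cite: CarlsonToledo1999, §2 (p. 5)] -/
theorem isInternal_eigenspace_pow {τ : V →ₗ[ℚ] V} {p : ℕ} (hτ : τ ^ p = 1) {ζ : ℂ} (hζ : IsPrimitiveRoot ζ p)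
    (hp : 0 < p) :
    DirectSum.IsInternal fun a : Fin p => Module.End.eigenspace (τ.baseChange ℂ) (ζ ^ (a : ℕ)) :=
  DirectSum.isInternal_submodule_of_iSupIndep_of_iSup_eq_top (iSupIndep_eigenspace_pow hζ)
    (iSup_eigenspace_pow_eq_top hτ hζ hp)

/-- Every element of `GL(V ⊗ ℂ)` commuting with `τ ⊗ ℂ` — in particular every `γ ⊗ ℂ` with `γ τ = τ γ` — maps each
summand `H(ζ^a)` into itself (the form `Set.MapsTo` consumed by `LinearMap.toMatrix_directSum_collectedBasis_eq_blockDiagonal'`).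
[cite: CarlsonToledo1999, §2 (p. 5)] -/
theorem mapsTo_eigenspace_of_comm {τ : V →ₗ[ℚ] V} {f : ℂ ⊗[ℚ] V →ₗ[ℂ] ℂ ⊗[ℚ] V}
    (hf : f ∘ₗ τ.baseChange ℂ = τ.baseChange ℂ ∘ₗ f) (μ : ℂ) :
    Set.MapsTo f (Module.End.eigenspace (τ.baseChange ℂ) μ) (Module.End.eigenspace (τ.baseChange ℂ) μ) := by
  intro x hx
  rw [SetLike.mem_coe, Module.End.mem_eigenspace_iff] at hx ⊢
  have h := congrArg (fun g => g x) hf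
  simp only [LinearMap.coe_comp, Function.comp_apply] at h
  rw [← h, hx, map_smul]

end Literature.AlgebraicGeometry.HodgeTheory

end
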